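import Mathlib
import Summits.Ventures.HodgeRepro2.T5SelfDualSplitting
import Summits.Ventures.HodgeRepro2.T5L2Positivity

/-!
# The signature formula integrated: `∫_S H(γ, γ) = ‖γ⁺‖²_{L²} − ‖γ⁻‖²_{L²}`

Tier-5 support for sub-step N1 (Hodge-theoretic side, route/T5-N1-hodge-p6.md §H1 (V5), §H3).
`T5SelfDualSplitting` (row 59) records, pointwise in the coframe model, the decomposition used in
Voisin's proof of the Hodge index theorem (Theorem 6.33, p0129 l. 17; proof l. 19): `Λ² = Λ⁺ ⊕ Λ⁻`
with `H(γ, δ) = γ ∧ δ̄` positive on `Λ⁺`, negative on `Λ⁻`, `Λ⁺ ⟂ Λ⁻`, and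
`H(γ, γ) = ‖γ⁺‖² − ‖γ⁻‖²`.  This file integrates it over a compact `S` against the volume
measure, exactly as rows 30 / 51 / 58 do for Theorem 6.32: for continuous coefficient fields,

* `∫_S H(γ, γ) dVol = ∫_S ‖γ⁺‖² dVol − ∫_S ‖γ⁻‖² dVol` (`integral_Hform_self`);
* `H` is positive definite on the self-dual fields and negative definite on the anti-self-dual
  fields, globally (`integral_Hform_self_re_pos_iff`, `integral_Hform_self_re_neg_iff`), and the
  two kinds are `H`-orthogonal in `L²` (`integral_Hform_eq_zero_of_self_of_neg`).

What stays prose: the identification of the harmonic self-dual / anti-self-dual forms with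
`H^+ ⊕ H^-` and the dimensions `b^± ` (Theorem 6.33 itself), and the bundle-versus-trivialisation
bookkeeping (memo §H2.2, §H3).
-/

namespace Summit.Ventures.HodgeRepro2.T5SelfDualGlobal

open Complex MeasureTheory T5HodgeStar T5PrimitiveOneOne T5SelfDualSplitting T5L2Positivity

variable {S : Type*} [MeasurableSpace S] {μ : Measure S}

/-- The Hodge operator is continuous (a linear map of a finite-dimensional space, written out). -/
theorem continuous_hodgeStar : Continuous hodgeStar := by
  refine continuous_pi fun i => ?_
  fin_cases i <;> simp only [hodgeStar] <;> fun_prop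

/-- `γ ↦ γ⁺` is continuous. -/
theorem continuous_selfDualPart : Continuous selfDualPart := by
  unfold selfDualPart
  exact (continuous_id.add continuous_hodgeStar).const_smul (1 / 2 : ℂ)

/-- `γ ↦ γ⁻` is continuous. -/
theorem continuous_antiSelfDualPart : Continuous antiSelfDualPart := by
  unfold antiSelfDualPart
  exact (continuous_id.sub continuous_hodgeStar).const_smul (1 / 2 : ℂ)

/-- The pointwise density `‖γ⁺‖² = Σ_i |γ⁺_i|²` of a coefficient field. -/
noncomputable def densityPlus (γ : S → TwoCovector) (s : S) : ℝ :=
  ∑ i, Complex.normSq (selfDualPart (γ s) i)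

/-- The pointwise density `‖γ⁻‖² = Σ_i |γ⁻_i|²`. -/
noncomputable def densityMinus (γ : S → TwoCovector) (s : S) : ℝ :=
  ∑ i, Complex.normSq (antiSelfDualPart (γ s) i)

omit [MeasurableSpace S] in
/-- Both densities are non-negative. -/
theorem densityPlus_nonneg (γ : S → TwoCovector) : 0 ≤ densityPlus γ :=
  fun _ => Finset.sum_nonneg (fun _ _ => Complex.normSq_nonneg _)

omit [MeasurableSpace S] in
/-- Both densities are non-negative. -/
theorem densityMinus_nonneg (γ : S → TwoCovector) : 0 ≤ densityMinus γ :=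
  fun _ => Finset.sum_nonneg (fun _ _ => Complex.normSq_nonneg _)

omit [MeasurableSpace S] in
/-- The density `‖γ⁺‖²` of a continuous field is continuous. -/
theorem continuous_densityPlus [TopologicalSpace S] {γ : S → TwoCovector} (hγ : Continuous γ) :
    Continuous (densityPlus γ) :=
  continuous_finsetSum _ fun i _ =>
    Complex.continuous_normSq.comp ((continuous_apply i).comp (continuous_selfDualPart.comp hγ))

omit [MeasurableSpace S] in
/-- The density `‖γ⁻‖²` of a continuous field is continuous. -/
theorem continuous_densityMinus [TopologicalSpace S] {γ : S → TwoCovector} (hγ : Continuous γ) :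
    Continuous (densityMinus γ) :=
  continuous_finsetSum _ fun i _ =>
    Complex.continuous_normSq.comp
      ((continuous_apply i).comp (continuous_antiSelfDualPart.comp hγ))

omit [MeasurableSpace S] in
/-- **The pointwise signature formula in real form**: `H(γ_s, γ_s) = ‖γ⁺_s‖² − ‖γ⁻_s‖²`
(`T5SelfDualSplitting.Hform_self_eq` with `T5PrimitiveOneOne.herm_self_eq_sum_normSq`). -/
theorem Hform_self_eq_density (γ : S → TwoCovector) (s : S) :
    Hform (γ s) (γ s) = ((densityPlus γ s - densityMinus γ s : ℝ) : ℂ) := by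
  rw [Hform_self_eq, herm_self_eq_sum_normSq, herm_self_eq_sum_normSq]
  simp [densityPlus, densityMinus]

/-- `∫_S H(γ, γ) dVol` is real: it is `∫_S (‖γ⁺‖² − ‖γ⁻‖²) dVol` (no integrability needed). -/
theorem integral_Hform_self_eq_ofReal (γ : S → TwoCovector) :
    ∫ s, Hform (γ s) (γ s) ∂μ = ((∫ s, (densityPlus γ s - densityMinus γ s) ∂μ : ℝ) : ℂ) := by
  simp_rw [Hform_self_eq_density]
  exact integral_ofReal

section Compact

variable [TopologicalSpace S] [OpensMeasurableSpace S] [CompactSpace S]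
  [IsFiniteMeasureOnCompacts μ]

/-- **The signature formula integrated** (the proof of Theorem 6.33 at the level of forms on a
compact `S`, in the model): `∫_S H(γ, γ) dVol = ∫_S ‖γ⁺‖² dVol − ∫_S ‖γ⁻‖² dVol` for a
continuous coefficient field. -/
theorem integral_Hform_self {γ : S → TwoCovector} (hγ : Continuous γ) :
    ∫ s, Hform (γ s) (γ s) ∂μ =
      ((∫ s, densityPlus γ s ∂μ - ∫ s, densityMinus γ s ∂μ : ℝ) : ℂ) := by
  rw [integral_Hform_self_eq_ofReal,
    integral_sub (integrable_of_continuous (continuous_densityPlus hγ))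
      (integrable_of_continuous (continuous_densityMinus hγ))]

variable [μ.IsOpenPosMeasure]

/-- **`H` is positive definite on the self-dual fields, globally**: for a continuous field with
`*γ_s = γ_s` everywhere, `∫_S H(γ, γ) > 0 ↔ γ ≠ 0`. -/
theorem integral_Hform_self_re_pos_iff {γ : S → TwoCovector} (hγ : Continuous γ)
    (hsd : ∀ s, hodgeStar (γ s) = γ s) :
    0 < (∫ s, Hform (γ s) (γ s) ∂μ).re ↔ γ ≠ 0 := by
  have hpt : ∀ s, Hform (γ s) (γ s) = ((∑ i, Complex.normSq (γ s i) : ℝ) : ℂ) := fun s => by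
    rw [Hform_of_hodgeStar_eq_self (hsd s), herm_self_eq_sum_normSq]
  simp_rw [hpt]
  rw [show (∫ s, ((∑ i, Complex.normSq (γ s i) : ℝ) : ℂ) ∂μ) =
    ((∫ s, ∑ i, Complex.normSq (γ s i) ∂μ : ℝ) : ℂ) from integral_ofReal, ofReal_re]
  have hq : Continuous fun s => ∑ i, Complex.normSq (γ s i) :=
    continuous_finsetSum _ fun i _ => Complex.continuous_normSq.comp ((continuous_apply i).comp hγ)
  have hq0 : 0 ≤ fun s => ∑ i, Complex.normSq (γ s i) :=
    fun _ => Finset.sum_nonneg (fun _ _ => Complex.normSq_nonneg _)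
  rw [integral_pos_iff_of_continuous hq hq0]
  constructor
  · rintro ⟨s, hs⟩ h0
    apply hs; rw [h0]; simp
  · intro h
    by_contra hcon
    push Not at hcon
    apply h
    ext s i
    have := hcon s
    rw [Finset.sum_eq_zero_iff_of_nonneg (fun i _ => Complex.normSq_nonneg (γ s i))] at this
    simpa using this i (Finset.mem_univ i)

/-- **`H` is negative definite on the anti-self-dual fields, globally**: for a continuous field
with `*γ_s = −γ_s` everywhere, `∫_S H(γ, γ) < 0 ↔ γ ≠ 0`. -/
theorem integral_Hform_self_re_neg_iff {γ : S → TwoCovector} (hγ : Continuous γ)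
    (hasd : ∀ s, hodgeStar (γ s) = -γ s) :
    (∫ s, Hform (γ s) (γ s) ∂μ).re < 0 ↔ γ ≠ 0 := by
  have hpt : ∀ s, Hform (γ s) (γ s) = -((∑ i, Complex.normSq (γ s i) : ℝ) : ℂ) := fun s => by
    rw [Hform_of_hodgeStar_eq_neg (hasd s), herm_self_eq_sum_normSq]
  simp_rw [hpt]
  rw [integral_neg, show (∫ s, ((∑ i, Complex.normSq (γ s i) : ℝ) : ℂ) ∂μ) =
    ((∫ s, ∑ i, Complex.normSq (γ s i) ∂μ : ℝ) : ℂ) from integral_ofReal, neg_re, ofReal_re,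
    neg_lt_zero]
  have hq : Continuous fun s => ∑ i, Complex.normSq (γ s i) :=
    continuous_finsetSum _ fun i _ => Complex.continuous_normSq.comp ((continuous_apply i).comp hγ)
  have hq0 : 0 ≤ fun s => ∑ i, Complex.normSq (γ s i) :=
    fun _ => Finset.sum_nonneg (fun _ _ => Complex.normSq_nonneg _)
  rw [integral_pos_iff_of_continuous hq hq0]
  constructor
  · rintro ⟨s, hs⟩ h0
    apply hs; rw [h0]; simp
  · intro h
    by_contra hcon
    push Not at hcon
    apply h
    ext s i
    have := hcon s
    rw [Finset.sum_eq_zero_iff_of_nonneg (fun i _ => Complex.normSq_nonneg (γ s i))] at this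
    simpa using this i (Finset.mem_univ i)

end Compact

/-- The self-dual and anti-self-dual fields are `H`-orthogonal in `L²`. -/
theorem integral_Hform_eq_zero_of_self_of_neg {γ δ : S → TwoCovector}
    (hγ : ∀ s, hodgeStar (γ s) = γ s) (hδ : ∀ s, hodgeStar (δ s) = -δ s) :
    ∫ s, Hform (γ s) (δ s) ∂μ = 0 := by
  simp [fun s => Hform_eq_zero_of_self_of_neg (hγ s) (hδ s)]

/-- The anti-self-dual and self-dual fields are `H`-orthogonal in `L²`. -/
theorem integral_Hform_eq_zero_of_neg_of_self {γ δ : S → TwoCovector}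
    (hγ : ∀ s, hodgeStar (γ s) = -γ s) (hδ : ∀ s, hodgeStar (δ s) = δ s) :
    ∫ s, Hform (γ s) (δ s) ∂μ = 0 := by
  simp [fun s => Hform_eq_zero_of_neg_of_self (hγ s) (hδ s)]

end Summit.Ventures.HodgeRepro2.T5SelfDualGlobal
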